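import Literature.NumberTheory.EllipticCurves.NewformsTwistPacketProofs
import Literature.NumberTheory.EllipticCurves.NewformsEqOfHeckeEigenvalueEqProofs
import Literature.NumberTheory.EllipticCurves.HeckeOperatorsAdjointProofs
import Literature.NumberTheory.EllipticCurves.CongruenceNumber
import HarnessLib

/-!
# O5: Petersson ORTHOGONALITY TRANSPORT under the quadratic twist across levels `M ∣ L`, `m² ∣ L`
# (`⟨F, z⟩ = 0 ⟺ ⟨F ⊗ ψ, z ⊗ ψ⟩ = 0` for a newform `F` of level `M`) — the engine of the one-way
# transport `r(F) ∣ r(F ⊗ ψ)` of the congruence number (`O5/CongruenceNumberTwistTransport.lean`)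

HONEST FRAMING (cell `b2b-bsdres`, run/shared/lean/b2b/bsd-rank1-residual/, verbatim in every
file): the goal of the cell is to DELETE the COMBINATION-SHAPED residual classes of the
Birch–Swinnerton-Dyer formula for ALL analytic-rank `≤ 1` elliptic curves over `ℚ` — assembled
STRICTLY from published theorems — so that the rank-`≤ 1` remainder becomes exactly the
CONSTRUCTION-SHAPED classes, which are TYPED, NOT attempted. This is not "finishing BSD". Lane
CLASS-CLOSURE, team o5 (`9 ∥ N`): planner o5-r2 GEN 7 (`gen7/TWIN-PROOF.md` Lemma 3 "orthogonality
transport" and Remark "ONE-WAY TRANSPORT"), typer cc-typer-5 (`O5/CongruenceNumberTwist.lean`, node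
R-TW `CongruenceNumberTwistJumpAtNine`); prover seat `b2b-bsdres-x11b3-p5` (gen. 10, cross-cell pool
item (P5-OWT)). THEOREMS ONLY (no definition, no named fact, no `sorry`); nothing booked; no
RESIDUAL-MAP mark / label / count moved; O5 OPEN; no `@[conjecture]` node touched or discharged.

## What (all inputs are TREE THEOREMS of the Atkin–Lehner–Li theory; `R = charTwist L …`)

* `peterssonProduct_eq_zero_of_heckeT_eigen_ne` — `T_p`-eigenvectors (`p ∤ N`) with distinct
  eigenvalues are Petersson-orthogonal (`heckeT_selfAdjoint_holds`, Diamond–Shurman Thm. 5.5.3, and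
  definiteness `eq_zero_of_peterssonProduct_self_eq_zero`).
* `charTwist_add` / `charTwist_smul` / `charTwist_zsmul` / `charTwist_sub` — linearity of `R` across
  levels (coefficientwise, `cuspCoeff_charTwist`; the tree's `PrimeTwist.charTwist_add` &c. are the
  same-level case).
* `heckeT_charTwist` — `T_p ∘ R = ψ(p) • R ∘ T_p` on ALL of `S_k(Γ₀(M))` for primes `p ∤ L`
  (`q`-expansions, Diamond–Shurman Prop. 5.3.1; the tree's `heckeT_charTwist_of_isNewform0` is the
  newform case).
* `top_le_span_sup_span` — `S_k(Γ₀(M)) = ℂF + B`, `B` the span of the Atkin–Lehner basis vectors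
  `[α_d]_k g` (`g` a newform of level `M' ∣ M`, `M'd ∣ M`) whose packet differs from `F`'s at
  infinitely many primes (`iSup_atkinLehnerComponent_eq_top`, `span_newforms0_holds`; a basis vector
  with cofinitely the packet of `F` IS `F`: strong multiplicity one
  `IsNewform0.level_eq_of_heckeEigenvalue_eq_holds` / `IsNewform0.eq_of_heckeEigenvalue_eq_holds`,
  Atkin–Lehner 1970, Thm. 4 — `degeneracyMap0_eq_of_finite`).
* `peterssonProduct_eq_zero_of_basis` / `_of_mem_span` — `B ⊥ F` and `R(B) ⊥ R F` (a prime `p ∤ L`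
  with `a_p(g) ≠ a_p(F)` always exists) = TWIN-PROOF Lemma 3 without primitivity, i.e. the
  Atkin–Lehner argument `R(⊕_{h ≠ F} V_h) ⊆ (ℂ F^ψ)^⊥`.
* **`peterssonProduct_eq_zero_iff_charTwist`** — `⟨F, z⟩ = 0 ⟺ ⟨R F, R z⟩ = 0` for every `z`.

References: [AtkinLehner1970] Thms. 3–5; [AtkinLi1978] §3; [Shimura1971] Prop. 3.64;
[DiamondShurman2005] Prop. 5.3.1, Thm. 5.5.3, Thm. 5.8.2–5.8.3; [AgasheRibetStein2012] §2.1;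
cell file `HOME/b2b-bsdres-o5-r2/gen7/TWIN-PROOF.md` (Lemma 3, Remark).
-/
noncomputable section

open scoped MatrixGroups ModularForm

open CongruenceSubgroup UpperHalfPlane

namespace Summit.BirchSwinnertonDyer.Rank1Residual.O5

open Literature.NumberTheory.EllipticCurves.ModularForms

namespace TwistTransport

/-- **`T_p`-eigenvectors with distinct eigenvalues are Petersson-orthogonal** (`p ∤ N`): if
`T_p x = a x`, `T_p y = b y`, `a ≠ b`, then `⟨x, y⟩ = 0` (`T_p` self-adjoint, Diamond–Shurman
Thm. 5.5.3: `a` is real when `x ≠ 0`, then `a⟨x,y⟩ = ⟨T_p x, y⟩ = ⟨x, T_p y⟩ = b⟨x,y⟩`).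
[cite: DiamondShurman2005, Thm. 5.5.3] -/
theorem peterssonProduct_eq_zero_of_heckeT_eigen_ne {N : ℕ} [NeZero N] {k : ℤ} {p : ℕ} [NeZero p]
    (hp : p.Prime) (hpN : ¬ p ∣ N) {x y : CuspForm (Gamma0 N) k} {a b : ℂ}
    (hx : heckeT (Gamma0 N) k p x = a • x) (hy : heckeT (Gamma0 N) k p y = b • y) (hab : a ≠ b) :
    peterssonProduct (Gamma0 N) k x y = 0 := by
  by_cases hx0 : x = 0
  · rw [hx0]
    exact peterssonProduct_zero_left _ k y
  have hxx : peterssonProduct (Gamma0 N) k x x ≠ 0 :=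
    fun h ↦ hx0 (eq_zero_of_peterssonProduct_self_eq_zero k x h)
  have hreal : (starRingEnd ℂ) a = a := by
    have h1 := heckeT_selfAdjoint_holds N k p hp hpN x x
    rw [hx, peterssonProduct_smul_left, peterssonProduct_smul_right] at h1
    exact mul_right_cancel₀ hxx h1
  have h2 := heckeT_selfAdjoint_holds N k p hp hpN x y
  rw [hx, hy, peterssonProduct_smul_left, peterssonProduct_smul_right, hreal] at h2
  have h3 : (a - b) * peterssonProduct (Gamma0 N) k x y = 0 := by
    rw [sub_mul, h2, sub_self]
  rcases mul_eq_zero.mp h3 with h | h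
  · exact absurd (sub_eq_zero.mp h) hab
  · exact h

section Twist

variable {M L m : ℕ} [NeZero M] [NeZero L] [NeZero m] {k : ℤ}
  (hML : M ∣ L) (hm : m ^ 2 ∣ L) {ψ : DirichletCharacter ℂ m} (hψ : ψ.IsQuadratic)

/-- The twist `S_k(Γ₀(M)) → S_k(Γ₀(L))` is additive (coefficientwise). [folklore] -/
theorem charTwist_add (hprim : ψ.IsPrimitive) (f g : CuspForm (Gamma0 M) k) :
    charTwist L hML hm hψ (f + g) = charTwist L hML hm hψ f + charTwist L hML hm hψ g := by
  refine eq_of_forall_cuspCoeff_eq_gamma0 fun n ↦ ?_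
  rw [cuspCoeff_add_form (one_mem_strictPeriods_coe_gamma0 L), cuspCoeff_charTwist L hML hm hψ hprim,
    cuspCoeff_charTwist L hML hm hψ hprim, cuspCoeff_charTwist L hML hm hψ hprim,
    cuspCoeff_add_form (one_mem_strictPeriods_coe_gamma0 M), mul_add]

/-- The twist `S_k(Γ₀(M)) → S_k(Γ₀(L))` is `ℂ`-homogeneous (coefficientwise). [folklore] -/
theorem charTwist_smul (hprim : ψ.IsPrimitive) (c : ℂ) (f : CuspForm (Gamma0 M) k) :
    charTwist L hML hm hψ (c • f) = c • charTwist L hML hm hψ f := by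
  refine eq_of_forall_cuspCoeff_eq_gamma0 fun n ↦ ?_
  rw [cuspCoeff_smul, cuspCoeff_charTwist L hML hm hψ hprim, cuspCoeff_charTwist L hML hm hψ hprim,
    cuspCoeff_smul, mul_left_comm]

/-- The twist `S_k(Γ₀(M)) → S_k(Γ₀(L))` is `ℤ`-homogeneous. [folklore] -/
theorem charTwist_zsmul (hprim : ψ.IsPrimitive) (z : ℤ) (f : CuspForm (Gamma0 M) k) :
    charTwist L hML hm hψ (z • f) = z • charTwist L hML hm hψ f := by
  rw [← Int.cast_smul_eq_zsmul ℂ z f, charTwist_smul hML hm hψ hprim, Int.cast_smul_eq_zsmul]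

/-- The twist `S_k(Γ₀(M)) → S_k(Γ₀(L))` is subtractive. [folklore] -/
theorem charTwist_sub (hprim : ψ.IsPrimitive) (f g : CuspForm (Gamma0 M) k) :
    charTwist L hML hm hψ (f - g) = charTwist L hML hm hψ f - charTwist L hML hm hψ g := by
  rw [sub_eq_add_neg, charTwist_add hML hm hψ hprim, ← neg_one_zsmul g,
    charTwist_zsmul hML hm hψ hprim, neg_one_zsmul, ← sub_eq_add_neg]

/-- **The Hecke commutation rule of the twist, for ALL forms**: for a prime `p ∤ L` and every
`f ∈ S_k(Γ₀(M))`, `T_p (R f) = ψ(p) • R (T_p f)` (Shimura 1971, Prop. 3.64; Atkin–Li 1978, §3) —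
by `q`-expansions: `aₙ(T_p h) = a_{pn}(h) + p^{k−1} a_{n/p}(h)` at both levels (Diamond–Shurman
Prop. 5.3.1), `aₙ(R f) = ψ(n) aₙ(f)`, `ψ(pn) = ψ(p)ψ(n)`, `ψ(p)² = 1`; the tree's
`heckeT_charTwist_of_isNewform0` is the newform case.
[cite: Shimura1971, Prop. 3.64] [cite: DiamondShurman2005, Prop. 5.3.1] -/
theorem heckeT_charTwist (hprim : ψ.IsPrimitive) (f : CuspForm (Gamma0 M) k) {p : ℕ} [NeZero p]
    (hp : p.Prime) (hpL : ¬ p ∣ L) :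
    heckeT (Gamma0 L) k p (charTwist L hML hm hψ f) =
      ψ p • charTwist L hML hm hψ (heckeT (Gamma0 M) k p f) := by
  have hpM : ¬ p ∣ M := fun h ↦ hpL (h.trans hML)
  have hpm : ¬ p ∣ m := fun h ↦ hpL ((h.trans (dvd_pow_self m two_ne_zero)).trans hm)
  have hunit : IsUnit ((p : ℕ) : ZMod m) := (ZMod.isUnit_prime_iff_not_dvd hp).mpr hpm
  have hsq : ψ p ^ 2 = 1 := apply_sq_eq_one_of_isQuadratic hψ hunit
  refine eq_of_forall_cuspCoeff_eq_gamma0 fun n ↦ ?_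
  have hT := qExpansion_coeff_heckeT_holds L k (charTwist L hML hm hψ f) p hp n
  rw [if_neg hpL] at hT
  change cuspCoeff (heckeT (Gamma0 L) k p (charTwist L hML hm hψ f)) n =
    cuspCoeff (charTwist L hML hm hψ f) (p * n) +
      (p : ℂ) ^ (k - 1) * (if p ∣ n then cuspCoeff (charTwist L hML hm hψ f) (n / p) else 0) at hT
  have hT' := qExpansion_coeff_heckeT_holds M k f p hp n
  rw [if_neg hpM] at hT'
  change cuspCoeff (heckeT (Gamma0 M) k p f) n =
    cuspCoeff f (p * n) + (p : ℂ) ^ (k - 1) * (if p ∣ n then cuspCoeff f (n / p) else 0) at hT'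
  rw [hT, cuspCoeff_smul, cuspCoeff_charTwist L hML hm hψ hprim f (p * n),
    cuspCoeff_charTwist L hML hm hψ hprim _ n, hT']
  by_cases hpn : p ∣ n
  · rw [if_pos hpn, if_pos hpn, cuspCoeff_charTwist L hML hm hψ hprim f (n / p)]
    obtain ⟨n', rfl⟩ := hpn
    rw [Nat.mul_div_cancel_left _ hp.pos]
    push_cast
    simp only [map_mul]
    linear_combination (-((p : ℂ) ^ (k - 1) * ψ (n' : ZMod m) * cuspCoeff f n')) * hsq
  · rw [if_neg hpn, if_neg hpn]
    push_cast
    simp only [map_mul]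
    ring

include hm hψ in
omit [NeZero L] [NeZero m] in
/-- `ψ(p) ≠ 0` for a prime `p ∤ L` (as `m ∣ L`, `p` is a unit mod `m` and `ψ(p)² = 1`). [folklore] -/
theorem apply_ne_zero_of_not_dvd {p : ℕ} (hp : p.Prime) (hpL : ¬ p ∣ L) : ψ p ≠ 0 := by
  have hpm : ¬ p ∣ m := fun h ↦ hpL ((h.trans (dvd_pow_self m two_ne_zero)).trans hm)
  have hunit : IsUnit ((p : ℕ) : ZMod m) := (ZMod.isUnit_prime_iff_not_dvd hp).mpr hpm
  have hsq : ψ p ^ 2 = 1 := apply_sq_eq_one_of_isQuadratic hψ hunit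
  intro h
  rw [h, zero_pow two_ne_zero] at hsq
  exact zero_ne_one hsq

end Twist

section Basis

variable {M : ℕ} [NeZero M] {k : ℤ} {F : CuspForm (Gamma0 M) k}

/-- **An Atkin–Lehner basis vector with (cofinitely) the packet of `F` is `F`**: for a newform `g`
of level `M'`, `M'd ∣ M`, with `a_p(g) = a_p(F)` for all but finitely many `p`: `M' = M` (strong
multiplicity one across levels, Atkin–Lehner 1970, Thm. 4), so `d = 1`, `g = F`, `[α_1]_k g = F`.
[cite: AtkinLehner1970, Thm. 4] -/
theorem degeneracyMap0_eq_of_finite {M' d : ℕ} [NeZero M'] [NeZero d] (hx : M' * d ∣ M)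
    {g : CuspForm (Gamma0 M') k} (hg : IsNewform0 g) (hF : IsNewform0 F)
    (hfin : {p : ℕ | p.Prime ∧ heckeEigenvalue g p ≠ heckeEigenvalue F p}.Finite) :
    degeneracyMap0 M' M d k g = F := by
  have hMM : M' = M := IsNewform0.level_eq_of_heckeEigenvalue_eq_holds hg hF hfin
  subst hMM
  have hd : d = 1 := by
    have h1 : M' * d ∣ M' * 1 := by rwa [mul_one]
    exact Nat.dvd_one.mp (Nat.dvd_of_mul_dvd_mul_left (NeZero.pos M') h1)
  subst hd
  have hgF : g = F := IsNewform0.eq_of_heckeEigenvalue_eq_holds hg hF hfin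
  subst hgF
  exact DFunLike.coe_injective (coe_degeneracyMap0_one M' M' k dvd_rfl g)

variable (M k F) in
/-- **The Atkin–Lehner basis spans** (Atkin–Lehner 1970, Thm. 5; tree
`iSup_atkinLehnerComponent_eq_top` + `span_newforms0_holds`), split as `ℂF + span(others)`,
"others" = the basis vectors `[α_d]_k g` whose packet differs from `F`'s at infinitely many primes
(the remaining ones equal `F`, `degeneracyMap0_eq_of_finite`). [cite: AtkinLehner1970, Thm. 5] -/
theorem top_le_span_sup_span (hF : IsNewform0 F) :
    (⊤ : Submodule ℂ (CuspForm (Gamma0 M) k)) ≤ (ℂ ∙ F) ⊔ Submodule.span ℂ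
      {v | ∃ (x : AtkinLehnerIndex M) (g : CuspForm (Gamma0 x.1.1) k), IsNewform0 g ∧
        degeneracyMap0 x.1.1 M x.1.2 k g = v ∧
        ¬ {p : ℕ | p.Prime ∧ heckeEigenvalue g p ≠ heckeEigenvalue F p}.Finite} := by
  rw [← iSup_atkinLehnerComponent_eq_top k M]
  refine iSup_le fun x ↦ ?_
  rw [atkinLehnerComponent, ← span_newforms0_holds x.1.1 k, Submodule.map_span]
  refine Submodule.span_le.mpr ?_
  rintro v ⟨g, hg, rfl⟩
  by_cases hfin : {p : ℕ | p.Prime ∧ heckeEigenvalue g p ≠ heckeEigenvalue F p}.Finite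
  · have hv : degeneracyMap0 x.1.1 M x.1.2 k g = F := degeneracyMap0_eq_of_finite x.2 hg hF hfin
    rw [SetLike.mem_coe, hv]
    exact Submodule.mem_sup_left (Submodule.mem_span_singleton_self F)
  · exact Submodule.mem_sup_right (Submodule.subset_span ⟨x, g, hg, rfl, hfin⟩)

end Basis

section Transport

variable {M L m : ℕ} [NeZero M] [NeZero L] [NeZero m] {k : ℤ}
  (hML : M ∣ L) (hm : m ^ 2 ∣ L) {ψ : DirichletCharacter ℂ m} (hψ : ψ.IsQuadratic)
  {F : CuspForm (Gamma0 M) k}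

/-- **A basis vector `v = [α_d]_k g` with a packet different from `F`'s is orthogonal to `F`, and
`Rv ⊥ RF`**: at a prime `p ∤ L` with `a_p(g) ≠ a_p(F)`, `T_p v = a_p(g) v`, `T_p F = a_p(F) F`
(`heckeT_degeneracyMap0`), `T_p (Rv) = ψ(p)a_p(g) Rv`, `T_p (RF) = ψ(p)a_p(F) RF` (`heckeT_charTwist`,
`ψ(p) ≠ 0`), and distinct eigenvalues are orthogonal — the orthogonality-transport lemma
`R(⊕_{h ≠ F} V_h) ⊆ (ℂ F^ψ)^⊥`. [cite: AtkinLehner1970, Thm. 4] [cite: DiamondShurman2005, Thm. 5.5.3] -/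
theorem peterssonProduct_eq_zero_of_basis (hprim : ψ.IsPrimitive) (hF : IsNewform0 F)
    (x : AtkinLehnerIndex M) {g : CuspForm (Gamma0 x.1.1) k} (hg : IsNewform0 g)
    (hinf : ¬ {p : ℕ | p.Prime ∧ heckeEigenvalue g p ≠ heckeEigenvalue F p}.Finite) :
    peterssonProduct (Gamma0 M) k F (degeneracyMap0 x.1.1 M x.1.2 k g) = 0 ∧
      peterssonProduct (Gamma0 L) k (charTwist L hML hm hψ F)
        (charTwist L hML hm hψ (degeneracyMap0 x.1.1 M x.1.2 k g)) = 0 := by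
  -- a prime `p ∤ L` at which the packets differ
  obtain ⟨p, ⟨hp, hne⟩, hpdiv⟩ := (Set.Infinite.sdiff hinf (Finset.finite_toSet L.divisors)).nonempty
  have hpL : ¬ p ∣ L :=
    fun h ↦ hpdiv (by rw [Finset.mem_coe, Nat.mem_divisors]; exact ⟨h, NeZero.ne L⟩)
  have hpM : ¬ p ∣ M := fun h ↦ hpL (h.trans hML)
  haveI : NeZero p := ⟨hp.ne_zero⟩
  -- eigen-equations at level `M`
  have hTg := heckeT_eq_heckeEigenvalue_smul g p (hg.2.1 p hp)
  have hTF := heckeT_eq_heckeEigenvalue_smul F p (hF.2.1 p hp)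
  have hTv : heckeT (Gamma0 M) k p (degeneracyMap0 x.1.1 M x.1.2 k g) =
      heckeEigenvalue g p • degeneracyMap0 x.1.1 M x.1.2 k g := by
    rw [heckeT_degeneracyMap0 x.2 hp hpM g, hTg, map_smul]
  refine ⟨peterssonProduct_eq_zero_of_heckeT_eigen_ne hp hpM hTF hTv hne.symm, ?_⟩
  -- eigen-equations at level `L`
  have hTRv : heckeT (Gamma0 L) k p (charTwist L hML hm hψ (degeneracyMap0 x.1.1 M x.1.2 k g)) =
      (ψ p * heckeEigenvalue g p) • charTwist L hML hm hψ (degeneracyMap0 x.1.1 M x.1.2 k g) := by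
    rw [heckeT_charTwist hML hm hψ hprim _ hp hpL, hTv, charTwist_smul hML hm hψ hprim, smul_smul]
  have hTRF : heckeT (Gamma0 L) k p (charTwist L hML hm hψ F) =
      (ψ p * heckeEigenvalue F p) • charTwist L hML hm hψ F := by
    rw [heckeT_charTwist hML hm hψ hprim _ hp hpL, hTF, charTwist_smul hML hm hψ hprim, smul_smul]
  have hne' : ψ p * heckeEigenvalue F p ≠ ψ p * heckeEigenvalue g p :=
    fun h ↦ hne.symm (mul_left_cancel₀ (apply_ne_zero_of_not_dvd hm hψ hp hpL) h)
  exact peterssonProduct_eq_zero_of_heckeT_eigen_ne hp hpL hTRF hTRv hne'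

/-- **Orthogonality transport on the complement of `F`**: every `b` in the span `B` of the basis
vectors with packet `≠` that of `F` satisfies `⟨F, b⟩ = 0` and `⟨R F, R b⟩ = 0` (the conditions are
`ℂ`-linear in `b`; `peterssonProduct_eq_zero_of_basis` on generators). [cite: AtkinLehner1970, Thm. 4] -/
theorem peterssonProduct_eq_zero_of_mem_span (hprim : ψ.IsPrimitive) (hF : IsNewform0 F)
    {b : CuspForm (Gamma0 M) k}
    (hb : b ∈ Submodule.span ℂ
      {v | ∃ (x : AtkinLehnerIndex M) (g : CuspForm (Gamma0 x.1.1) k), IsNewform0 g ∧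
        degeneracyMap0 x.1.1 M x.1.2 k g = v ∧
        ¬ {p : ℕ | p.Prime ∧ heckeEigenvalue g p ≠ heckeEigenvalue F p}.Finite}) :
    peterssonProduct (Gamma0 M) k F b = 0 ∧
      peterssonProduct (Gamma0 L) k (charTwist L hML hm hψ F) (charTwist L hML hm hψ b) = 0 := by
  induction hb using Submodule.span_induction with
  | mem v hv =>
    obtain ⟨x, g, hg, rfl, hinf⟩ := hv
    exact peterssonProduct_eq_zero_of_basis hML hm hψ hprim hF x hg hinf
  | zero =>
    refine ⟨peterssonProduct_zero_right k F, ?_⟩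
    rw [← zero_smul ℂ (0 : CuspForm (Gamma0 M) k), charTwist_smul hML hm hψ hprim, zero_smul]
    exact peterssonProduct_zero_right k _
  | add u w _ _ hu hw =>
    refine ⟨?_, ?_⟩
    · rw [peterssonProduct_add_right k, hu.1, hw.1, add_zero]
    · rw [charTwist_add hML hm hψ hprim, peterssonProduct_add_right k, hu.2, hw.2, add_zero]
  | smul c u _ hu =>
    refine ⟨?_, ?_⟩
    · rw [peterssonProduct_smul_right, hu.1, mul_zero]
    · rw [charTwist_smul hML hm hψ hprim, peterssonProduct_smul_right, hu.2, mul_zero]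

/-- **Orthogonality transport (both directions)**: for a newform `F` of level `M` and every `z`,
`⟨F, z⟩ = 0 ⟺ ⟨R F, R z⟩ = 0` (`z = c F + b`, `b ∈ B`; both products are `c` times a nonzero
norm, `R F ≠ 0`). [cite: AtkinLehner1970, Thms. 4–5] [cite: AgasheRibetStein2012, §2.1] -/
theorem peterssonProduct_eq_zero_iff_charTwist (hprim : ψ.IsPrimitive) (hF : IsNewform0 F)
    (z : CuspForm (Gamma0 M) k) :
    peterssonProduct (Gamma0 M) k F z = 0 ↔
      peterssonProduct (Gamma0 L) k (charTwist L hML hm hψ F) (charTwist L hML hm hψ z) = 0 := by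
  obtain ⟨a, ha, b, hb, rfl⟩ :=
    Submodule.mem_sup.mp (top_le_span_sup_span M k F hF (Submodule.mem_top (x := z)))
  obtain ⟨c, rfl⟩ := Submodule.mem_span_singleton.mp ha
  have hb' := peterssonProduct_eq_zero_of_mem_span hML hm hψ hprim hF hb
  have h1 : cuspCoeff F 1 ≠ 0 := by rw [show cuspCoeff F 1 = 1 from hF.2.2]; exact one_ne_zero
  have hF0 : F ≠ 0 := fun h ↦ h1 (by rw [h, cuspCoeff_zero_form (one_mem_strictPeriods_coe_gamma0 M)])
  have hRF0 : charTwist L hML hm hψ F ≠ 0 := charTwist_ne_zero L hML hm hψ hprim h1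
  have hFF : peterssonProduct (Gamma0 M) k F F ≠ 0 :=
    fun h ↦ hF0 (eq_zero_of_peterssonProduct_self_eq_zero k F h)
  have hRR : peterssonProduct (Gamma0 L) k (charTwist L hML hm hψ F) (charTwist L hML hm hψ F) ≠ 0 :=
    fun h ↦ hRF0 (eq_zero_of_peterssonProduct_self_eq_zero k _ h)
  rw [peterssonProduct_add_right k, peterssonProduct_smul_right, hb'.1, add_zero,
    charTwist_add hML hm hψ hprim, charTwist_smul hML hm hψ hprim, peterssonProduct_add_right k,
    peterssonProduct_smul_right, hb'.2, add_zero, mul_eq_zero, mul_eq_zero, or_iff_left hFF,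
    or_iff_left hRR]

end Transport

end TwistTransport

end Summit.BirchSwinnertonDyer.Rank1Residual.O5

end
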